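import Summits.ResolutionOfSingularities.ResolutionOfSingularities.Theorems.PurelyInseparableDim4Equimultiple
import Summits.ResolutionOfSingularities.ResolutionOfSingularities.Theorems.WildConesCampaignW46AffineFermat
import Summits.ResolutionOfSingularities.ResolutionOfSingularities.Theorems.MarkedTransferCampaignW32K32PrimeDirectrix
import Literature.AlgebraicGeometry.Resolution.PointBlowupKangaroo
import HarnessLib

/-!
# Sub-row (N) «NEAR ⟺ multiplicity» of the E2(3,3) dictionary: the local ring `𝒪_{𝔸⁵,0}/(z^p + F)` is a
# multiplicity-`p` hypersurface point, so every point presented by it has ONE Hilbert–Samuel function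
(cell `res-dim4-pi`, desk WORD #52 (c); row (N) `E2OfCJS.NearRow` of seat p-2 g2's `…E2OfCJSRows`)

[OURS · counted 0 · a presentation lemma + a call of TREE theorems (W4.6 `CampaignW46.AffineFermat.isRegularLocalRing_stalk`
/ `ringKrullDim_stalk_origin`; W3.2 `CampaignW32.K32Prime.hsFun_eq_of_hypersurface_presentations` and the `Helpers`
of `…Corridor3HypersurfacePoints`; TY-3 `PIDim4.Equimultiple.*`); nothing here is a statement of any manuscript and
nothing here proves E2(3,3), `NoIsolatedTrap 3 3` or resolution of singularities in dimension ≥ 4 / characteristic `p`.]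

For a prime `p`, a field `L` of characteristic `p` and `F ∈ L[x₁..x₄]` with `ord₀ F = p`:
* `stalkIdeal_hypSheaf_origin` — the stalk at the origin `ξ` of the ideal sheaf `hypSheaf p F = (z^p + F)·𝒪_{𝔸⁵}` is
  the principal ideal of the germ `g` of `z^p + F`;
* `germ_hyp_mem_pow` / `germ_hyp_not_mem_pow_succ` — `g ∈ 𝔪_ξ^p ∖ 𝔪_ξ^{p+1}` (the order of `z^p + F` at the origin is
  EXACTLY `p`: `Equimultiple.natCast_le_idealOrder_hypSheaf_iff`, `ordZero_translate_hyp_le`);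
* **`exists_hypersurface_presentation`** — `∃ g ∈ 𝔪^p ∖ 𝔪^{p+1}` with
  `𝒪_{𝔸⁵,ξ} ⧸ stalkIdeal (hypSheaf p F) ξ ≃+* 𝒪_{𝔸⁵,ξ} ⧸ (g)`, `𝒪_{𝔸⁵,ξ}` regular local of dimension `5`;
* **`hsFun_eq_of_stalk_iso_hypStalk`** — two points `x ∈ X`, `y ∈ Y` of arbitrary schemes whose local rings are
  isomorphic to `𝒪_{𝔸⁵,ξ}/(z^p + F)` resp. `𝒪_{𝔸⁵,ξ}/(z^p + G)` (`ord₀ F = ord₀ G = p`) have the SAME Hilbert–Samuel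
  function `H^N_X(x) = H^N_Y(y)` at EVERY level `N` (for `N ≥ 4` both are `hypersurfaceHFe (N+1) p`, Bennett / CJS
  Thm. 2.3 in the tree's W3.2 form; for `N ≤ 4` both are the Hilbert function of a multiplicity-`p` hypersurface in a
  regular `5`-space, `ψ = 4`);
* `nearRow_unfolded` — the literal body of p-2 g2's `E2OfCJS.NearRow` at `p = 3` (the `[PerfectField L]` and
  `[IsLocallyNoetherian]` binders of the row are not needed); the one-line adapter `nearRow : NearRow` is appended to
  the rows file once it is in the tree.

bears_on: LADDER-RESOLUTION:D157-DOOR2 (res-dim4-pi · F4-I(3,3) · E2 dictionary sub-row (N)).  Seat res-dim4-p-1 g2.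
Supports stmt-ResolutionOfSingularities-16155 (helper).
-/

set_option linter.dupNamespace false

noncomputable section

open CategoryTheory AlgebraicGeometry IsLocalRing MvPolynomial
open Literature.AlgebraicGeometry.Resolution Scheme.IdealSheafData
open Literature.AlgebraicGeometry.Resolution.Hauser2010
open Literature.AlgebraicGeometry.Hironaka2017.SpecOrders
open Literature.RingTheory.HilbertSamuel

namespace Summit.ResolutionOfSingularities.ResolutionOfSingularities.Theorems.PIDim4

namespace E2Near

open AffinePointBlowup (P ξ A)
open Summit.ResolutionOfSingularities.ResolutionOfSingularities.Theorems.SigmaMaxModificationsCorridor3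

variable {L : Type} [Field L]

/-! ## 1. The germ of `z^p + F` at the origin generates the stalk of `hypSheaf p F` -/

/-- The stalk of `hypSheaf p F = (z^p + F)·𝒪_{𝔸⁵_L}` at the origin is generated by the germ of `z^p + F`.
[folklore] -/
theorem stalkIdeal_hypSheaf_origin (p : ℕ) (F : MvPolynomial (Fin 4) L) :
    stalkIdeal (hypSheaf p F) (ξ 4 L) =
      Ideal.span {algebraMap (A 4 L) (St (A 4 L) (ξ 4 L)) (hyp p F)} := by
  rw [Equimultiple.hypSheaf_eq_shf, stalkIdeal_shf, Ideal.map_span, Set.image_singleton]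

/-- The origin of `𝔸⁵_L` is the rational point `(0, 0)`. [folklore] -/
theorem asIdeal_ξ_eq_vanishingIdeal :
    (ξ 4 L).asIdeal = MvPolynomial.vanishingIdeal L {(Fin.cons 0 0 : Fin (4 + 1) → L)} := by
  have hcons : (Fin.cons 0 0 : Fin (4 + 1) → L) = 0 := by
    funext i
    exact Fin.cases rfl (fun _ => rfl) i
  change Literature.AlgebraicGeometry.Resolution.originIdeal L (4 + 1) = _
  ext g
  rw [Literature.AlgebraicGeometry.Resolution.mem_originIdeal_iff, MvPolynomial.mem_vanishingIdeal_singleton_iff,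
    hcons, MvPolynomial.aeval_zero]
  exact Iff.rfl

/-- **The order of `z^p + F` at the origin is at least `p`** when `ord₀ F = p`. [cite: Hauser2010, §C (order of X at a point)] -/
theorem le_idealOrder_hypSheaf_origin (p : ℕ) [hp : Fact p.Prime] [CharP L p] (F : MvPolynomial (Fin 4) L)
    (hF : ordZero F = p) : (p : ℕ∞) ≤ idealOrder (hypSheaf p F) (ξ 4 L) := by
  rw [Equimultiple.natCast_le_idealOrder_hypSheaf_iff F asIdeal_ξ_eq_vanishingIdeal,
    Equimultiple.natCast_le_ordZero_translate_hyp_iff]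
  have hcoeff : ∀ d : Fin 4 →₀ ℕ, d.degree < p → coeff d F = 0 := fun d hd =>
    coeff_eq_zero_of_degree_lt_ordZero (by rw [hF]; exact_mod_cast hd)
  refine ⟨?_, fun d _ hd => ?_⟩
  · rw [zero_pow hp.out.ne_zero, zero_add, MvPolynomial.eval_zero]
    exact hcoeff 0 (by rw [map_zero]; exact hp.out.pos)
  · rw [PointBlowup.translate_zero]
    exact hcoeff d hd

/-- **The order of `z^p + F` at the origin is exactly `p`** when `ord₀ F = p`. [cite: Hauser2010, §C (order of X at a point)] -/
theorem idealOrder_hypSheaf_origin (p : ℕ) [Fact p.Prime] [CharP L p] (F : MvPolynomial (Fin 4) L)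
    (hF : ordZero F = p) : idealOrder (hypSheaf p F) (ξ 4 L) = p :=
  le_antisymm (Equimultiple.idealOrder_hypSheaf_le F 0 0 asIdeal_ξ_eq_vanishingIdeal)
    (le_idealOrder_hypSheaf_origin p F hF)

/-- The germ of `z^p + F` lies in `𝔪_ξ^p`. [folklore] -/
theorem germ_hyp_mem_pow (p : ℕ) [Fact p.Prime] [CharP L p] (F : MvPolynomial (Fin 4) L) (hF : ordZero F = p) :
    algebraMap (A 4 L) (St (A 4 L) (ξ 4 L)) (hyp p F) ∈ maximalIdeal ((P 4 L).presheaf.stalk (ξ 4 L)) ^ p := by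
  have h := (le_idealOrder_iff (hypSheaf p F) (ξ 4 L) p).mp (le_idealOrder_hypSheaf_origin p F hF)
  rw [stalkIdeal_hypSheaf_origin, Ideal.span_singleton_le_iff_mem] at h
  exact h

/-- The germ of `z^p + F` does NOT lie in `𝔪_ξ^{p+1}`. [folklore] -/
theorem germ_hyp_not_mem_pow_succ (p : ℕ) [hp : Fact p.Prime] [CharP L p] (F : MvPolynomial (Fin 4) L)
    (hF : ordZero F = p) :
    algebraMap (A 4 L) (St (A 4 L) (ξ 4 L)) (hyp p F) ∉
      maximalIdeal ((P 4 L).presheaf.stalk (ξ 4 L)) ^ (p + 1) := by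
  intro hmem
  have h : ((p + 1 : ℕ) : ℕ∞) ≤ idealOrder (hypSheaf p F) (ξ 4 L) := by
    rw [le_idealOrder_iff, stalkIdeal_hypSheaf_origin, Ideal.span_singleton_le_iff_mem]
    exact hmem
  rw [idealOrder_hypSheaf_origin p F hF] at h
  have : p + 1 ≤ p := by exact_mod_cast h
  omega

/-! ## 2. The presentation and the ambient -/

/-- **The hypersurface presentation of `HypStalk`**: for `ord₀ F = p` there is `g ∈ 𝔪^p ∖ 𝔪^{p+1}` in `𝒪_{𝔸⁵_L, ξ}` with
`𝒪_{𝔸⁵,ξ} ⧸ stalkIdeal (hypSheaf p F) ξ ≃+* 𝒪_{𝔸⁵,ξ} ⧸ (g)`. [OURS · sub-row (N)] [folklore] -/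
theorem exists_hypersurface_presentation (p : ℕ) [Fact p.Prime] [CharP L p] (F : MvPolynomial (Fin 4) L)
    (hF : ordZero F = p) :
    ∃ g : (P 4 L).presheaf.stalk (ξ 4 L),
      g ∈ maximalIdeal ((P 4 L).presheaf.stalk (ξ 4 L)) ^ p ∧
        g ∉ maximalIdeal ((P 4 L).presheaf.stalk (ξ 4 L)) ^ (p + 1) ∧
          Nonempty (((P 4 L).presheaf.stalk (ξ 4 L) ⧸ stalkIdeal (hypSheaf p F) (ξ 4 L)) ≃+*
            (P 4 L).presheaf.stalk (ξ 4 L) ⧸ Ideal.span {g}) :=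
  ⟨_, germ_hyp_mem_pow p F hF, germ_hyp_not_mem_pow_succ p F hF,
    ⟨Ideal.quotEquivOfEq (stalkIdeal_hypSheaf_origin p F)⟩⟩

/-- `𝒪_{𝔸⁵_L, ξ}` is a regular local ring (tree, W4.6). [cite: StacksProject, Tag 056S (Lemma 33.25.3)] -/
theorem isRegularLocalRing_stalk_origin (p : ℕ) [Fact p.Prime] [CharP L p] :
    IsRegularLocalRing ((P 4 L).presheaf.stalk (ξ 4 L)) :=
  CampaignW46.AffineFermat.isRegularLocalRing_stalk p L 4 (ξ 4 L)

/-- `dim 𝒪_{𝔸⁵_L, ξ} = 5` (tree, W4.6). [folklore] -/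
theorem ringKrullDim_stalk_origin :
    ringKrullDim ((P 4 L).presheaf.stalk (ξ 4 L)) = ((4 + 1 : ℕ) : WithBot ℕ∞) :=
  CampaignW46.AffineFermat.ringKrullDim_stalk_origin L 4 rfl

/-! ## 3. One Hilbert–Samuel function for all presented points -/

/-- **Sub-row (N), content form.**  Let `p` be prime, `L` a field of characteristic `p`, `F, G ∈ L[x₁..x₄]` with
`ord₀ F = ord₀ G = p`, and let `x ∈ X`, `y ∈ Y` be points of schemes whose local rings are isomorphic to
`𝒪_{𝔸⁵_L,ξ}/(z^p + F)` resp. `𝒪_{𝔸⁵_L,ξ}/(z^p + G)`.  Then `H^N_X(x) = H^N_Y(y)` for every `N`: hypersurface points of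
the same multiplicity `p` in a regular `5`-dimensional ambient have one Hilbert–Samuel function (Bennett; CJS Thm. 2.3 /
Def. 2.28, tree W3.2 `hsFun_eq_of_hypersurface_presentations` for `N ≥ 4`, the `Helpers` for `N ≤ 4`).
[OURS · sub-row (N) of the E2 dictionary] [cite: CossartJannsenSaito2020, Def. 2.28 and Thm. 2.3] -/
theorem hsFun_eq_of_stalk_iso_hypStalk (p : ℕ) [hp : Fact p.Prime] [CharP L p] (F G : MvPolynomial (Fin 4) L)
    (hF : ordZero F = p) (hG : ordZero G = p) {X : Scheme.{0}} (x : X) {Y : Scheme.{0}} (y : Y)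
    (eX : X.presheaf.stalk x ≅
      CommRingCat.of ((P 4 L).presheaf.stalk (ξ 4 L) ⧸ stalkIdeal (hypSheaf p F) (ξ 4 L)))
    (eY : Y.presheaf.stalk y ≅
      CommRingCat.of ((P 4 L).presheaf.stalk (ξ 4 L) ⧸ stalkIdeal (hypSheaf p G) (ξ 4 L)))
    (N : ℕ) : Scheme.hsFun X N x = Scheme.hsFun Y N y := by
  haveI := isRegularLocalRing_stalk_origin (L := L) p
  have hdim := ringKrullDim_stalk_origin (L := L)
  obtain ⟨gF, hgF, hgF', ⟨φF⟩⟩ := exists_hypersurface_presentation p F hF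
  obtain ⟨gG, hgG, hgG', ⟨φG⟩⟩ := exists_hypersurface_presentation p G hG
  let εX : X.presheaf.stalk x ≃+* (P 4 L).presheaf.stalk (ξ 4 L) ⧸ Ideal.span {gF} :=
    eX.commRingCatIsoToRingEquiv.trans φF
  let εY : Y.presheaf.stalk y ≃+* (P 4 L).presheaf.stalk (ξ 4 L) ⧸ Ideal.span {gG} :=
    eY.commRingCatIsoToRingEquiv.trans φG
  by_cases hN : 4 ≤ N
  · exact CampaignW32.K32Prime.hsFun_eq_of_hypersurface_presentations hdim hdim (by omega) (by omega)
      hp.out.one_le hgF hgF' hgG hgG' εX εY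
  · have hgF1 : gF ∈ maximalIdeal _ := Ideal.pow_le_self hp.out.ne_zero hgF
    have hgG1 : gG ∈ maximalIdeal _ := Ideal.pow_le_self hp.out.ne_zero hgG
    have hgF0 : gF ≠ 0 := fun h => hgF' (h ▸ zero_mem _)
    have hgG0 : gG ≠ 0 := fun h => hgG' (h ▸ zero_mem _)
    rw [Scheme.hsFun_def, Scheme.hsFun_def, Helpers.hsPsi_eq_of_stalk_ringEquiv hdim hgF1 hgF0 εX,
      Helpers.hsPsi_eq_of_stalk_ringEquiv hdim hgG1 hgG0 εY,
      show N - (4 + 1 - 1) = 0 by omega, hilbertSamuelFun_zero, hilbertSamuelFun_zero,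
      Helpers.hilbertFun_stalk_eq_of_stalk_ringEquiv hdim hgF hgF' εX,
      Helpers.hilbertFun_stalk_eq_of_stalk_ringEquiv hdim hgG hgG' εY]

/-- **p-2 g2's row `E2OfCJS.NearRow`, literal body** (at `p = 3`, with the row's unused binders `[PerfectField L]`,
`[IsLocallyNoetherian]` kept for literal agreement): two points presented over the same field of characteristic `3` by
residual polynomials of order exactly `3` have the same Hilbert–Samuel function at every level.
[OURS · sub-row (N)] [cite: CossartJannsenSaito2020, Def. 2.28 and Thm. 2.3] -/
theorem nearRow_unfolded :
    ∀ (L : Type) [Field L] [CharP L 3] [PerfectField L] (F G : MvPolynomial (Fin 4) L),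
      ordZero F = (3 : ℕ∞) → ordZero G = (3 : ℕ∞) →
      ∀ (X : Scheme.{0}) [IsLocallyNoetherian X] (x : X) (Y : Scheme.{0}) [IsLocallyNoetherian Y] (y : Y),
        Nonempty (X.presheaf.stalk x ≅
          CommRingCat.of ((P 4 L).presheaf.stalk (ξ 4 L) ⧸ stalkIdeal (hypSheaf 3 F) (ξ 4 L))) →
        Nonempty (Y.presheaf.stalk y ≅
          CommRingCat.of ((P 4 L).presheaf.stalk (ξ 4 L) ⧸ stalkIdeal (hypSheaf 3 G) (ξ 4 L))) →
        ∀ N : ℕ, Scheme.hsFun X N x = Scheme.hsFun Y N y := by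
  intro L _ _ _ F G hF hG X _ x Y _ y hX hY N
  haveI : Fact (Nat.Prime 3) := ⟨Nat.prime_three⟩
  obtain ⟨eX⟩ := hX
  obtain ⟨eY⟩ := hY
  exact hsFun_eq_of_stalk_iso_hypStalk 3 F G (by exact_mod_cast hF) (by exact_mod_cast hG) x y eX eY N

end E2Near

end Summit.ResolutionOfSingularities.ResolutionOfSingularities.Theorems.PIDim4

end
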